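import Summits.QuantumFields.YangMills.Theorems.UnitScaleTiltHistoryTailOneSupplier
import Summits.QuantumFields.YangMills.Theorems.AlphaInputsT3ACv3InnerLiftFromRegionalThm1
import HarnessLib

/-!
# `UnitScaleTiltHistoryTailOneSupplierFL` — THE ONE-SUPPLIER THEOREM OF `HistoryTailL` WITH THE (FL) ROW IN THE CURRENCY OF RECORD: ★w1 g0's `hLift` binder
# (OWNER RULING g24-№4, 2026-08-28T00:44Z: «the (FL) deliverable of record := that `hLift` binder, verbatim, supplied kinematically») at ANY constant `B_L ≥ 1`, the record
# carrying `B₃ ≥ B_L·L²` — cell `ym3-torus`, route `UnitScaleTilt`, crux stmt-QuantumFields-19936 (v5p9, 2′χ), width seat `ym-ust-19936-w5` (g0); companion of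
# `…HistoryTailOneSupplier` (p590846)

WHAT.  `…HistoryTailOneSupplier` proved `PinnedPartsT3ACRecFLChi L` (hence 2′χ, hence the crux at all odd `L`) from (T) at ANY constants plus the supplier rows, the (FL) row
being `InnerFineLiftsT3 F 𝔠 γ hγ hγ1 K 𝔠.B₃`.  DEPMAP v3.5 reads (FL) through ★w1's `AlphaInputsT3AC.innerFineLiftsT3_of_regionalLifts` (`…v3InnerLiftFromRegionalThm1`):
(FL) at `B·L²` ⇐ `hLift` at `B` — «for every `k + 1 ≤ K`, every admissible non-trivial level-`(k+1)` history and every level-`k` field `V` windowed inside `Ω_{k+1}(h)` there is a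
finest field with exact `k`-fold `blockAvg ℰp`-averages `V` on `bondsIn k Ω_{k+1}(h)` and finest plaquettes under `Ω_{k+1}(h)` `< B·ε_W(k+1)·L^{−2k}`» ([Balaban1985Variational]
Thm 1 (8) p.279, existence + fine regularity, read on the region with free seam; the Newton∕IFT target on the (LL) engine).  THIS FILE substitutes that currency:
* §1 `innerFineLiftsT3_of_regionalLifts_le` — `hLift` at `B_L ≥ 1` and `B_L·L² ≤ 𝔠.B₃` ⇒ `InnerFineLiftsT3 … 𝔠.B₃` (★w1's theorem, its `θ ≥ 0` proviso discharged by `θBal_pos`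
  on the record window, then `innerFineLiftsT3_mono`).
* §2 ★★ `pinnedPartsT3ACRecFLChi_of_thm1_regionalLifts_rows` ∕ `alphaInputsT3ACv3RecChi_of_thm1_regionalLifts_rows` ∕ ★★★ `historyTailL_of_thm1In8_regionalLifts_rows_allL` —
  the three theorems of `…HistoryTailOneSupplier` §§3–4 with the per-family (FL) conjunct of `hrows` REPLACED by «`∃ B_L ≥ 1`, `B_L·L² ≤ B₃` ∧ `hLift` at `B_L` for every coupling of
  the window and every run» — so, BY NAME: `HistoryTailL` ⇐ ⟨v5kC's T8 text⟩ ∧ ∀ odd `L > 1` ∃ floor∕box such that every `(B, a₀, a₁)` in it is served, beyond profile thresholds, by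
  a record with exact profile, `B₃ = B`, the free size rows, ★w1's `hLift` (at some `B_L` with `B_L·L² ≤ B`) and the (O″χ) χ data rows.  The supplier's floor is therefore
  `B₀ := B_L·L²` for its kinematic constant `B_L` (absolute or `M₁`-polynomial at the seed's `M₁`, OWNER 23:33:27Z).
HONEST FRAMING.  Composition∕restriction of quantifiers over landed theorems; `hLift`, (T)∕T8 and (O″χ) are HYPOTHESES (never asserted) — (FL) is NOT proved here, nor anything
of [Balaban1985UV3]'s expansion or [Balaban1985Variational]; def-free; count-neutral helper (`--supports stmt-QuantumFields-19936`); registry untouched.  YM₃ on the three-torus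
is rung R3 of the programme, NOT the Clay problem: nothing here bears on d = 4, infinite volume, or a mass gap.

References: T. Bałaban, Commun. Math. Phys. 102 (1985) 277–309 [Balaban1985Variational] (Thm 1 (6)–(8) pp.278–279, (11)–(14) pp.279–280, Prop 8 p.304); Commun. Math. Phys.
102 (1985) 255–275 [Balaban1985UV3] ((5) p.256, (7) p.257, (40)–(42) p.266, (47) p.267, (68) p.273, (71) p.273, Thm 2 p.272); C. King, Commun. Math. Phys. 102 (1986) 649–677
[King1986] ((3.12) p.657).
-/

set_option autoImplicit false

noncomputable section

namespace Summit.QuantumFields.YangMills.Theorems.HistoryTailOneSupplier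

open MeasureTheory Set
open scoped Matrix.Norms.L2Operator
open Literature.MathematicalPhysics.QuantumFieldTheory.Balaban1983to89
open Literature.MathematicalPhysics.QuantumFieldTheory.Balaban1983to89.T3ContinuumYM3Torus
open Literature.MathematicalPhysics.QuantumFieldTheory.Balaban1983to89.T3UnitLawDensityEML (ℰp)
open Literature.MathematicalPhysics.QuantumFieldTheory.Balaban1983to89.T3UnitScaleTilt (θBal)
open Literature.MathematicalPhysics.QuantumFieldTheory.Balaban1983to89.T3MinimiserStabilityReduction (θBal_pos)
open Literature.MathematicalPhysics.QuantumFieldTheory.Balaban1983to89.T3PrintedMinimiserExistence (Thm1GlobalMinAt)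
open Literature.MathematicalPhysics.QuantumFieldTheory.Balaban1983to89.T3LowerAlongMinimisersSplit (MinimisersIn8At)
open Literature.MathematicalPhysics.QuantumFieldTheory.Balaban1983to89.ExpMeanLog (deltaSU deltaSU_pos)
open Literature.MathematicalPhysics.QuantumFieldTheory.Balaban1983to89.B10Eq38TorusDomains (plaqsIn)
open Literature.MathematicalPhysics.QuantumFieldTheory.Balaban1983to89.B10Eq42TorusConstraint (bondsIn)
open Literature.MathematicalPhysics.QuantumFieldTheory.Balaban1985CMP102.Setting
open Summit.QuantumFields.Balaban3D.Carriers
open Summit.QuantumFields.Balaban3D.Proofs.Primitives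
open Summit.QuantumFields.Balaban3D.Proofs.Thresholds (Q0 Q0_pos)
open B7Prop2Explicit (C0 C0_pos)

/-! ## §1 (FL) at the record's `B₃` from `hLift` at any `B_L ≥ 1` with `B_L·L² ≤ B₃` -/

/-- **(FL) AT THE RECORD'S CONSTANT FROM ★w1's `hLift` BINDER AT ANY `B_L ≥ 1` WITH `B_L·L² ≤ B₃`**: `innerFineLiftsT3_of_regionalLifts` (its proviso `0 ≤ θ(K−k)` holds on the
record's coupling window by `θBal_pos`) followed by `innerFineLiftsT3_mono`. [cite: Balaban1985Variational, Thm 1 (8) p.279, (11)–(14) pp.279–280; Balaban1985UV3, (7) p.257, (40)+(42) p.266] -/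
theorem innerFineLiftsT3_of_regionalLifts_le {F : T3Family} {𝔠 : AlphaConsts F.L (suGroupModel 2).N} {γ : ℝ} {hγ : 0 < γ}
    {hγ1 : γ ≤ (min 𝔠.gamma0 1) ^ 2} {K : ℕ} {B : ℝ} (hB : 1 ≤ B) (hBB : B * (F.L : ℝ) ^ 2 ≤ 𝔠.B₃)
    (hLift : ∀ (k : ℕ), k + 1 ≤ K → ∀ (h : Hist (F.P K) (k + 1)),
      Hist.Admissible 𝔠.lane.carrier.M₁ (rcolOf (T3Scales F γ hγ (hγ1.trans (sq_min_one_le _ 𝔠.gamma0_pos)) K) 𝔠.lane.carrier) (k + 1) h →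
      h ≠ Hist.triv (F.P K) (k + 1) → ∀ (V : GaugeField (F.P K) k (Matrix.specialUnitaryGroup (Fin 2) ℂ)),
        (∀ Q : Plaq (F.P K) k, Q ∈ plaqsIn k (Omega 𝔠.lane.carrier.M₁
            (rcolOf (T3Scales F γ hγ (hγ1.trans (sq_min_one_le _ 𝔠.gamma0_pos)) K) 𝔠.lane.carrier) (k + 1) h (k + 1)) →
          GaugeGroup.dist1 (GaugeField.plaqHol V Q) ≤ 2 * (F.L : ℝ) ^ 2 * avgWindowFactor F.L * θBal F.L γ 𝔠.b₀ 𝔠.p₀ (K - k)) →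
        ∃ U : GaugeField (F.P K) 0 (Matrix.specialUnitaryGroup (Fin 2) ℂ),
          (∀ b : PBond (F.P K) k, b ∈ bondsIn k (Omega 𝔠.lane.carrier.M₁
              (rcolOf (T3Scales F γ hγ (hγ1.trans (sq_min_one_le _ 𝔠.gamma0_pos)) K) 𝔠.lane.carrier) (k + 1) h (k + 1)) →
            Averaging.iter (fun i => BlockAveraging.blockAvg (P := F.P K) (j := i) ℰp) k U b = V b) ∧
          ∀ q : Plaq (F.P K) 0, q ∈ plaqsIn 0 (Omega 𝔠.lane.carrier.M₁
              (rcolOf (T3Scales F γ hγ (hγ1.trans (sq_min_one_le _ 𝔠.gamma0_pos)) K) 𝔠.lane.carrier) (k + 1) h (k + 1)) →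
            GaugeGroup.dist1 (GaugeField.plaqHol U q) <
              B * (2 * (F.L : ℝ) ^ 2 * avgWindowFactor F.L * θBal F.L γ 𝔠.b₀ 𝔠.p₀ (K - k)) * (((F.L : ℝ) ^ k)⁻¹) ^ 2) :
    AlphaInputsT3AC.InnerFineLiftsT3 F 𝔠 γ hγ hγ1 K 𝔠.B₃ := by
  refine innerFineLiftsT3_mono (AlphaInputsT3AC.innerFineLiftsT3_of_regionalLifts F 𝔠 γ hγ hγ1 K hB (fun k _ => ?_) hLift) hBB
  exact (θBal_pos F.hL.2.le hγ (hγ1.trans (sq_min_one_le _ 𝔠.gamma0_pos)) 𝔠.b₀_pos 𝔠.p₀ _).le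


/-! ## §2 The display, the 2′χ text and the crux with the (FL) row in the currency of record (`hLift` at any `B_L ≥ 1`, record `B₃ ≥ B_L·L²`) -/

/-- ★★ **THE 2′χ DISPLAY OF RECORD FROM (T) AT ANY CONSTANTS AND THE SUPPLIER ROWS, (FL) AS `hLift`** — `pinnedPartsT3ACRecFLChi_of_thm1_rows` with the per-family (FL)
conjunct supplied by §1 from «`∃ B_L`, `1 ≤ B_L`, `B_L·L² ≤ B₃`, `hLift` at `B_L` for every coupling of the window and every run».
[cite: Balaban1985Variational, Thm 1 (6)–(8) pp.278–279, (11)–(14) pp.279–280; Balaban1985UV3, (7) p.257, (40)–(42) p.266, (47) p.267, (68) p.273 and Thm 2 p.272] -/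
theorem pinnedPartsT3ACRecFLChi_of_thm1_regionalLifts_rows {L : ℕ} (hL : 1 < L)
    (hT : ∃ a₀ a₁ B₃ : ℝ, 0 < a₀ ∧ 0 < a₁ ∧ 0 < B₃ ∧ Thm1GlobalMinAt L a₀ a₁ B₃)
    {B₀ A₀ A₁ : ℝ} (hA₀ : 0 < A₀) (hA₁ : 0 < A₁)
    (hrows : ∀ (B a₀ a₁ : ℝ), B₀ ≤ B → 1 ≤ 2 * B → 0 < a₀ → a₀ ≤ A₀ → 0 < a₁ → a₁ ≤ A₁ → B * a₁ ≤ a₀ →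
        (143 * ((((3 + 4 : ℕ) : ℝ)) ^ 2 / 4) ^ 2) * (2 * (B * a₁)) ≤ 1 / 3 →
        2 * (2 * (B * a₁)) ≤ 2 * deltaSU (Fin 2) / (((3 + 4) * L : ℕ) : ℝ) ^ 2 →
        Thm1GlobalMinAt L a₀ a₁ B →
        ∃ (b₁ p₁ : ℝ), ∀ (b₀ p₀ : ℝ), b₁ ≤ b₀ → p₁ ≤ p₀ →
          ∃ 𝔠 : AlphaConsts L (suGroupModel 2).N, 𝔠.b₀ = b₀ ∧ 𝔠.p₀ = p₀ ∧ 𝔠.B₃ = B ∧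
            4 * 𝔠.B₃ * (L : ℝ) ^ 2 * avgWindowFactor L ≤ 𝔠.C68 ∧
            Real.exp (𝔠.p₀ - 1) ≤ 3 * C0 3 * 𝔠.C68 * (𝔠.b₀ * Q0 𝔠.p₀) ∧
            (𝔠.b₀ * Q0 𝔠.p₀) * (2 * (L : ℝ) ^ 2 * avgWindowFactor L) ^ 2 ≤ 3 * C0 3 * 𝔠.C68 * a₁ ^ 2 ∧
            7 * L + 3 ≤ 𝔠.M₁ ∧
            ∀ (F : T3Family) (hF : F.L = L),
              (∃ B_L : ℝ, 1 ≤ B_L ∧ B_L * (F.L : ℝ) ^ 2 ≤ (hF ▸ 𝔠).B₃ ∧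
                ∀ (γ : ℝ) (hγ : 0 < γ) (hγ1 : γ ≤ (min (hF ▸ 𝔠).gamma0 1) ^ 2) (K : ℕ),
                ∀ (k : ℕ), k + 1 ≤ K → ∀ (h : Hist (F.P K) (k + 1)),
                  Hist.Admissible (hF ▸ 𝔠).lane.carrier.M₁ (rcolOf (T3Scales F γ hγ (hγ1.trans (sq_min_one_le _ (hF ▸ 𝔠).gamma0_pos)) K) (hF ▸ 𝔠).lane.carrier) (k + 1) h →
                  h ≠ Hist.triv (F.P K) (k + 1) → ∀ (V : GaugeField (F.P K) k (Matrix.specialUnitaryGroup (Fin 2) ℂ)),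
                    (∀ Q : Plaq (F.P K) k, Q ∈ plaqsIn k (Omega (hF ▸ 𝔠).lane.carrier.M₁
                        (rcolOf (T3Scales F γ hγ (hγ1.trans (sq_min_one_le _ (hF ▸ 𝔠).gamma0_pos)) K) (hF ▸ 𝔠).lane.carrier) (k + 1) h (k + 1)) →
                      GaugeGroup.dist1 (GaugeField.plaqHol V Q) ≤ 2 * (F.L : ℝ) ^ 2 * avgWindowFactor F.L * θBal F.L γ (hF ▸ 𝔠).b₀ (hF ▸ 𝔠).p₀ (K - k)) →
                    ∃ U : GaugeField (F.P K) 0 (Matrix.specialUnitaryGroup (Fin 2) ℂ),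
                      (∀ b : PBond (F.P K) k, b ∈ bondsIn k (Omega (hF ▸ 𝔠).lane.carrier.M₁
                          (rcolOf (T3Scales F γ hγ (hγ1.trans (sq_min_one_le _ (hF ▸ 𝔠).gamma0_pos)) K) (hF ▸ 𝔠).lane.carrier) (k + 1) h (k + 1)) →
                        Averaging.iter (fun i => BlockAveraging.blockAvg (P := F.P K) (j := i) ℰp) k U b = V b) ∧
                      ∀ q : Plaq (F.P K) 0, q ∈ plaqsIn 0 (Omega (hF ▸ 𝔠).lane.carrier.M₁
                          (rcolOf (T3Scales F γ hγ (hγ1.trans (sq_min_one_le _ (hF ▸ 𝔠).gamma0_pos)) K) (hF ▸ 𝔠).lane.carrier) (k + 1) h (k + 1)) →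
                        GaugeGroup.dist1 (GaugeField.plaqHol U q) <
                          B_L * (2 * (F.L : ℝ) ^ 2 * avgWindowFactor F.L * θBal F.L γ (hF ▸ 𝔠).b₀ (hF ▸ 𝔠).p₀ (K - k)) * (((F.L : ℝ) ^ k)⁻¹) ^ 2) ∧
              (∀ (γ : ℝ) (hγ : 0 < γ) (hγ1 : γ ≤ (min (hF ▸ 𝔠).gamma0 1) ^ 2) (K : ℕ),
                (∃ Ut : (k : ℕ) → GaugeField (F.P K) k (Matrix.specialUnitaryGroup (Fin 2) ℂ) →
                    GaugeField (F.P K) 0 (Matrix.specialUnitaryGroup (Fin 2) ℂ),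
                  AlphaInputsT3AC.TrivMinimiserRowsT3 F (hF ▸ 𝔠) γ hγ hγ1 a₀ a₁ K Ut) →
                ∃ Ut : (k : ℕ) → GaugeField (F.P K) k (Matrix.specialUnitaryGroup (Fin 2) ℂ) →
                    GaugeField (F.P K) 0 (Matrix.specialUnitaryGroup (Fin 2) ℂ),
                  AlphaInputsT3AC.TrivMinimiserRowsT3 F (hF ▸ 𝔠) γ hγ hγ1 a₀ a₁ K Ut ∧
                    AlphaInputsT3AC.DataRowsT3XChi F (hF ▸ 𝔠) γ hγ hγ1 K Ut)) :
    AlphaInputsT3AC.PinnedPartsT3ACRecFLChi L := by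
  refine pinnedPartsT3ACRecFLChi_of_thm1_rows hL hT hA₀ hA₁ (B₀ := B₀) fun B a₀ a₁ h1 h2 h3 h4 h5 h6 h7 h8 h9 h10 => ?_
  obtain ⟨b₁, p₁, hrec⟩ := hrows B a₀ a₁ h1 h2 h3 h4 h5 h6 h7 h8 h9 h10
  refine ⟨b₁, p₁, fun b₀ p₀ hb hp => ?_⟩
  obtain ⟨𝔠, e1, e2, e3, s1, s2, s3, s4, hFO⟩ := hrec b₀ p₀ hb hp
  refine ⟨𝔠, e1, e2, e3, s1, s2, s3, s4, fun F hF => ⟨fun γ hγ hγ1 K => ?_, (hFO F hF).2⟩⟩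
  obtain ⟨B_L, hBL, hBB, hLift⟩ := (hFO F hF).1
  exact innerFineLiftsT3_of_regionalLifts_le hBL hBB (hLift γ hγ hγ1 K)

/-- ★★ **THE REGISTERED 2′χ TEXT FROM (T) AT ANY CONSTANTS AND THE SUPPLIER ROWS, (FL) AS `hLift`** (§2's display through w2 g0's
`alphaInputsT3ACv3RecChi_of_pinnedPartsRecFLChi`; serves 20520's v5kC 2′χ identically). [cite: Balaban1985UV3, Thm 2 p.272 and (47) p.267; Balaban1985Variational, Thm 1 (8) p.279] -/
theorem alphaInputsT3ACv3RecChi_of_thm1_regionalLifts_rows {L : ℕ} (hL : 1 < L)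
    (hT : ∃ a₀ a₁ B₃ : ℝ, 0 < a₀ ∧ 0 < a₁ ∧ 0 < B₃ ∧ Thm1GlobalMinAt L a₀ a₁ B₃)
    {B₀ A₀ A₁ : ℝ} (hA₀ : 0 < A₀) (hA₁ : 0 < A₁)
    (hrows : ∀ (B a₀ a₁ : ℝ), B₀ ≤ B → 1 ≤ 2 * B → 0 < a₀ → a₀ ≤ A₀ → 0 < a₁ → a₁ ≤ A₁ → B * a₁ ≤ a₀ →
        (143 * ((((3 + 4 : ℕ) : ℝ)) ^ 2 / 4) ^ 2) * (2 * (B * a₁)) ≤ 1 / 3 →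
        2 * (2 * (B * a₁)) ≤ 2 * deltaSU (Fin 2) / (((3 + 4) * L : ℕ) : ℝ) ^ 2 →
        Thm1GlobalMinAt L a₀ a₁ B →
        ∃ (b₁ p₁ : ℝ), ∀ (b₀ p₀ : ℝ), b₁ ≤ b₀ → p₁ ≤ p₀ →
          ∃ 𝔠 : AlphaConsts L (suGroupModel 2).N, 𝔠.b₀ = b₀ ∧ 𝔠.p₀ = p₀ ∧ 𝔠.B₃ = B ∧
            4 * 𝔠.B₃ * (L : ℝ) ^ 2 * avgWindowFactor L ≤ 𝔠.C68 ∧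
            Real.exp (𝔠.p₀ - 1) ≤ 3 * C0 3 * 𝔠.C68 * (𝔠.b₀ * Q0 𝔠.p₀) ∧
            (𝔠.b₀ * Q0 𝔠.p₀) * (2 * (L : ℝ) ^ 2 * avgWindowFactor L) ^ 2 ≤ 3 * C0 3 * 𝔠.C68 * a₁ ^ 2 ∧
            7 * L + 3 ≤ 𝔠.M₁ ∧
            ∀ (F : T3Family) (hF : F.L = L),
              (∃ B_L : ℝ, 1 ≤ B_L ∧ B_L * (F.L : ℝ) ^ 2 ≤ (hF ▸ 𝔠).B₃ ∧
                ∀ (γ : ℝ) (hγ : 0 < γ) (hγ1 : γ ≤ (min (hF ▸ 𝔠).gamma0 1) ^ 2) (K : ℕ),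
                ∀ (k : ℕ), k + 1 ≤ K → ∀ (h : Hist (F.P K) (k + 1)),
                  Hist.Admissible (hF ▸ 𝔠).lane.carrier.M₁ (rcolOf (T3Scales F γ hγ (hγ1.trans (sq_min_one_le _ (hF ▸ 𝔠).gamma0_pos)) K) (hF ▸ 𝔠).lane.carrier) (k + 1) h →
                  h ≠ Hist.triv (F.P K) (k + 1) → ∀ (V : GaugeField (F.P K) k (Matrix.specialUnitaryGroup (Fin 2) ℂ)),
                    (∀ Q : Plaq (F.P K) k, Q ∈ plaqsIn k (Omega (hF ▸ 𝔠).lane.carrier.M₁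
                        (rcolOf (T3Scales F γ hγ (hγ1.trans (sq_min_one_le _ (hF ▸ 𝔠).gamma0_pos)) K) (hF ▸ 𝔠).lane.carrier) (k + 1) h (k + 1)) →
                      GaugeGroup.dist1 (GaugeField.plaqHol V Q) ≤ 2 * (F.L : ℝ) ^ 2 * avgWindowFactor F.L * θBal F.L γ (hF ▸ 𝔠).b₀ (hF ▸ 𝔠).p₀ (K - k)) →
                    ∃ U : GaugeField (F.P K) 0 (Matrix.specialUnitaryGroup (Fin 2) ℂ),
                      (∀ b : PBond (F.P K) k, b ∈ bondsIn k (Omega (hF ▸ 𝔠).lane.carrier.M₁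
                          (rcolOf (T3Scales F γ hγ (hγ1.trans (sq_min_one_le _ (hF ▸ 𝔠).gamma0_pos)) K) (hF ▸ 𝔠).lane.carrier) (k + 1) h (k + 1)) →
                        Averaging.iter (fun i => BlockAveraging.blockAvg (P := F.P K) (j := i) ℰp) k U b = V b) ∧
                      ∀ q : Plaq (F.P K) 0, q ∈ plaqsIn 0 (Omega (hF ▸ 𝔠).lane.carrier.M₁
                          (rcolOf (T3Scales F γ hγ (hγ1.trans (sq_min_one_le _ (hF ▸ 𝔠).gamma0_pos)) K) (hF ▸ 𝔠).lane.carrier) (k + 1) h (k + 1)) →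
                        GaugeGroup.dist1 (GaugeField.plaqHol U q) <
                          B_L * (2 * (F.L : ℝ) ^ 2 * avgWindowFactor F.L * θBal F.L γ (hF ▸ 𝔠).b₀ (hF ▸ 𝔠).p₀ (K - k)) * (((F.L : ℝ) ^ k)⁻¹) ^ 2) ∧
              (∀ (γ : ℝ) (hγ : 0 < γ) (hγ1 : γ ≤ (min (hF ▸ 𝔠).gamma0 1) ^ 2) (K : ℕ),
                (∃ Ut : (k : ℕ) → GaugeField (F.P K) k (Matrix.specialUnitaryGroup (Fin 2) ℂ) →
                    GaugeField (F.P K) 0 (Matrix.specialUnitaryGroup (Fin 2) ℂ),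
                  AlphaInputsT3AC.TrivMinimiserRowsT3 F (hF ▸ 𝔠) γ hγ hγ1 a₀ a₁ K Ut) →
                ∃ Ut : (k : ℕ) → GaugeField (F.P K) k (Matrix.specialUnitaryGroup (Fin 2) ℂ) →
                    GaugeField (F.P K) 0 (Matrix.specialUnitaryGroup (Fin 2) ℂ),
                  AlphaInputsT3AC.TrivMinimiserRowsT3 F (hF ▸ 𝔠) γ hγ hγ1 a₀ a₁ K Ut ∧
                    AlphaInputsT3AC.DataRowsT3XChi F (hF ▸ 𝔠) γ hγ hγ1 K Ut)) :
    AlphaInputsT3ACv3RecChi L :=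
  alphaInputsT3ACv3RecChi_of_pinnedPartsRecFLChi (pinnedPartsT3ACRecFLChi_of_thm1_regionalLifts_rows hL hT hA₀ hA₁ hrows)

/-- ★★★ **`HistoryTailL` ⇐ ⟨v5kC's `stub_thm1In8GlobalMin` TEXT⟩ ∧ (∀ odd `L > 1`, THE SUPPLIER ROWS WITH (FL) AS ★w1's `hLift`)** — stmt-QuantumFields-19936 BY NAME
from 19200's T8 text and, at every odd block size, a floor∕box on which every `(B, a₀, a₁)` is served beyond profile thresholds by a record with exact profile, `B₃ = B`, the free
size rows, `hLift` at some `B_L ≥ 1` with `B_L·L² ≤ B`, and the (O″χ) χ data rows (w2 g0's `historyTailL_of_pinnedPartsRecFLChi` ∘ §2).  DEPMAP v3.5 for 19936 as one arrow: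
(T) ⇐ 19200 by name (compose ★r1 g5's `thm1In8GlobalMin_of_v8Leaves(4)`), (FL) ⇐ `hLift` ⇐ Newton on the (LL) engine, (O″χ) ⇐ NODE O.
[cite: Balaban1985UV3, (5) p.256, (47) p.267, (71) p.273 and Thm 2 p.272; Balaban1985Variational, Thm 1 (8) p.279, (11)–(14) pp.279–280 and Prop 8 p.304; King1986, (3.12) p.657] -/
theorem historyTailL_of_thm1In8_regionalLifts_rows_allL
    (hT8 : ∀ L : ℕ, Odd L → 1 < L → ∃ a₀ a₁ B₃ : ℝ, 0 < a₀ ∧ 0 < a₁ ∧ 0 < B₃ ∧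
      Thm1GlobalMinAt L a₀ a₁ B₃ ∧ MinimisersIn8At L a₀ a₁ B₃)
    (hrows : ∀ L : ℕ, Odd L → 1 < L → ∃ (B₀ A₀ A₁ : ℝ), 0 < A₀ ∧ 0 < A₁ ∧
      ∀ (B a₀ a₁ : ℝ), B₀ ≤ B → 1 ≤ 2 * B → 0 < a₀ → a₀ ≤ A₀ → 0 < a₁ → a₁ ≤ A₁ → B * a₁ ≤ a₀ →
        (143 * ((((3 + 4 : ℕ) : ℝ)) ^ 2 / 4) ^ 2) * (2 * (B * a₁)) ≤ 1 / 3 →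
        2 * (2 * (B * a₁)) ≤ 2 * deltaSU (Fin 2) / (((3 + 4) * L : ℕ) : ℝ) ^ 2 →
        Thm1GlobalMinAt L a₀ a₁ B →
        ∃ (b₁ p₁ : ℝ), ∀ (b₀ p₀ : ℝ), b₁ ≤ b₀ → p₁ ≤ p₀ →
          ∃ 𝔠 : AlphaConsts L (suGroupModel 2).N, 𝔠.b₀ = b₀ ∧ 𝔠.p₀ = p₀ ∧ 𝔠.B₃ = B ∧
            4 * 𝔠.B₃ * (L : ℝ) ^ 2 * avgWindowFactor L ≤ 𝔠.C68 ∧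
            Real.exp (𝔠.p₀ - 1) ≤ 3 * C0 3 * 𝔠.C68 * (𝔠.b₀ * Q0 𝔠.p₀) ∧
            (𝔠.b₀ * Q0 𝔠.p₀) * (2 * (L : ℝ) ^ 2 * avgWindowFactor L) ^ 2 ≤ 3 * C0 3 * 𝔠.C68 * a₁ ^ 2 ∧
            7 * L + 3 ≤ 𝔠.M₁ ∧
            ∀ (F : T3Family) (hF : F.L = L),
              (∃ B_L : ℝ, 1 ≤ B_L ∧ B_L * (F.L : ℝ) ^ 2 ≤ (hF ▸ 𝔠).B₃ ∧
                ∀ (γ : ℝ) (hγ : 0 < γ) (hγ1 : γ ≤ (min (hF ▸ 𝔠).gamma0 1) ^ 2) (K : ℕ),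
                ∀ (k : ℕ), k + 1 ≤ K → ∀ (h : Hist (F.P K) (k + 1)),
                  Hist.Admissible (hF ▸ 𝔠).lane.carrier.M₁ (rcolOf (T3Scales F γ hγ (hγ1.trans (sq_min_one_le _ (hF ▸ 𝔠).gamma0_pos)) K) (hF ▸ 𝔠).lane.carrier) (k + 1) h →
                  h ≠ Hist.triv (F.P K) (k + 1) → ∀ (V : GaugeField (F.P K) k (Matrix.specialUnitaryGroup (Fin 2) ℂ)),
                    (∀ Q : Plaq (F.P K) k, Q ∈ plaqsIn k (Omega (hF ▸ 𝔠).lane.carrier.M₁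
                        (rcolOf (T3Scales F γ hγ (hγ1.trans (sq_min_one_le _ (hF ▸ 𝔠).gamma0_pos)) K) (hF ▸ 𝔠).lane.carrier) (k + 1) h (k + 1)) →
                      GaugeGroup.dist1 (GaugeField.plaqHol V Q) ≤ 2 * (F.L : ℝ) ^ 2 * avgWindowFactor F.L * θBal F.L γ (hF ▸ 𝔠).b₀ (hF ▸ 𝔠).p₀ (K - k)) →
                    ∃ U : GaugeField (F.P K) 0 (Matrix.specialUnitaryGroup (Fin 2) ℂ),
                      (∀ b : PBond (F.P K) k, b ∈ bondsIn k (Omega (hF ▸ 𝔠).lane.carrier.M₁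
                          (rcolOf (T3Scales F γ hγ (hγ1.trans (sq_min_one_le _ (hF ▸ 𝔠).gamma0_pos)) K) (hF ▸ 𝔠).lane.carrier) (k + 1) h (k + 1)) →
                        Averaging.iter (fun i => BlockAveraging.blockAvg (P := F.P K) (j := i) ℰp) k U b = V b) ∧
                      ∀ q : Plaq (F.P K) 0, q ∈ plaqsIn 0 (Omega (hF ▸ 𝔠).lane.carrier.M₁
                          (rcolOf (T3Scales F γ hγ (hγ1.trans (sq_min_one_le _ (hF ▸ 𝔠).gamma0_pos)) K) (hF ▸ 𝔠).lane.carrier) (k + 1) h (k + 1)) →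
                        GaugeGroup.dist1 (GaugeField.plaqHol U q) <
                          B_L * (2 * (F.L : ℝ) ^ 2 * avgWindowFactor F.L * θBal F.L γ (hF ▸ 𝔠).b₀ (hF ▸ 𝔠).p₀ (K - k)) * (((F.L : ℝ) ^ k)⁻¹) ^ 2) ∧
              (∀ (γ : ℝ) (hγ : 0 < γ) (hγ1 : γ ≤ (min (hF ▸ 𝔠).gamma0 1) ^ 2) (K : ℕ),
                (∃ Ut : (k : ℕ) → GaugeField (F.P K) k (Matrix.specialUnitaryGroup (Fin 2) ℂ) →
                    GaugeField (F.P K) 0 (Matrix.specialUnitaryGroup (Fin 2) ℂ),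
                  AlphaInputsT3AC.TrivMinimiserRowsT3 F (hF ▸ 𝔠) γ hγ hγ1 a₀ a₁ K Ut) →
                ∃ Ut : (k : ℕ) → GaugeField (F.P K) k (Matrix.specialUnitaryGroup (Fin 2) ℂ) →
                    GaugeField (F.P K) 0 (Matrix.specialUnitaryGroup (Fin 2) ℂ),
                  AlphaInputsT3AC.TrivMinimiserRowsT3 F (hF ▸ 𝔠) γ hγ hγ1 a₀ a₁ K Ut ∧
                    AlphaInputsT3AC.DataRowsT3XChi F (hF ▸ 𝔠) γ hγ hγ1 K Ut)) :
    Summit.QuantumFields.YangMills.Theses.UnitScaleTilt.HistoryTailL := by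
  refine HistoryTailLaneTailChi.historyTailL_of_pinnedPartsRecFLChi fun L hLo hL => ?_
  obtain ⟨a₀, a₁, B₃, ha₀, ha₁, hB₃, hT, -⟩ := hT8 L hLo hL
  obtain ⟨B₀, A₀, A₁, hA₀, hA₁, h⟩ := hrows L hLo hL
  exact pinnedPartsT3ACRecFLChi_of_thm1_regionalLifts_rows hL ⟨a₀, a₁, B₃, ha₀, ha₁, hB₃, hT⟩ hA₀ hA₁ h

end Summit.QuantumFields.YangMills.Theorems.HistoryTailOneSupplier

end
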